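import Summits.Ventures.HSemireg.AmplificationChainPridhamPerfect
import HarnessLib

/-!
# Venture HSemireg — the ARTINIAN PRESENTATION over a pointed Artinian base, CONSTRUCTED

HONEST FRAMING. Lean index of the computation cell `pub-hsemireg` (theory seat 3, «algebraisation step»). Nothing
about any explicit variety is asserted; nothing here says HC, HC_CM or HC_AV is proved. Theorems only (0 `def`,
0 `sorry`, no new axiom, no Literature fact declared); pure Mathlib + Motives bookkeeping.

Seat lit-3's `LiftsOverArtinianPointsAt` and seat p7's `PerfectLiftsOverArtinianPointsAt` QUANTIFY over
presentations `X_A = 𝒳 ×_S Spec A`, `X_B = X_A ×_{Spec A} Spec B`, `j : X₀ ⟶ X_B` (three `IsPullback` squares and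
one equation). A CONSUMER of the lifting property — the glue «versal chart + lifting property ⟹ formally smooth
chart» of `AmplificationChainVersalChart.lean` — must CONSTRUCT one presentation for given `(A ↠ B → ℂ, a)`. This
file does it once (`exists_artinianPresentation`: the two Mathlib pullbacks and the map `j` induced from
`e ≫ ι_{s₀}` by pasting against the cartesian fibre square), together with three one-line identities about
`Spec ℂ` and fibres used there. [folklore]
-/

noncomputable section

open CategoryTheory CategoryTheory.Limits AlgebraicGeometry
open Literature.AlgebraicGeometry.Motives

namespace Summit.Ventures.HSemireg

section Presentation

/-- The structure morphism of `Spec ℂ` as a `ℂ`-scheme is the identity. [folklore] -/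
theorem specOver_self_hom_eq_id : (specOver ℂ ℂ).hom = 𝟙 _ := by
  change Spec.map (CommRingCat.ofHom (algebraMap ℂ ℂ)) = 𝟙 _
  rw [Algebra.algebraMap_self, CommRingCat.ofHom_id, Spec.map_id]

/-- For a `ℂ`-morphism `g : X₀ ⟶ 𝒳_s` into a fibre, `g ≫ (𝒳_s → Spec ℂ)` is the structure map of `X₀`. [folklore] -/
theorem left_comp_fiberOverToSpec_left {𝒳 S X₀ : SchemeOver ℂ} (π : 𝒳 ⟶ S) (s : ComplexPoints S)
    (g : X₀ ⟶ fiberOver π s) : g.left ≫ (fiberOverToSpec π s).left = X₀.hom := by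
  have h := Over.w g
  erw [fiberOver_hom, specOver_self_hom_eq_id, Category.comp_id] at h
  exact h

/-- Transport of the fibre inclusion along an equality of points. [folklore] -/
theorem eqToHom_comp_fiberι' {𝒳 S : SchemeOver ℂ} (π : 𝒳 ⟶ S) {s s' : ComplexPoints S} (h : s = s') :
    eqToHom (congrArg (fiberOver π) h) ≫ fiberι π s' = fiberι π s := by
  subst h
  simp

/-- **The Artinian presentation exists.** For `π : 𝒳 ⟶ S`, a `ℂ`-point `s₀`, a model `e : X₀ ≅ 𝒳_{s₀}`,
`ℂ`-algebra maps `φ : A → B`, `ρ : B → ℂ` and an `A`-point `a` of `S` whose closed point is `s₀`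
(`Spec(ρ ∘ φ) ≫ a = s₀`), the base changes `X_A := 𝒳 ×_S Spec A`, `X_B := X_A ×_{Spec A} Spec B` and the
induced `j : X₀ ⟶ X_B` form the three cartesian squares of `PerfectLiftsOverArtinianPointsAt` with
`j ≫ i ≫ g_A = e ≫ ι_{s₀}` (pasting of pullbacks; `X₀ ≅ 𝒳_{s₀}` is cartesian over `Spec ℂ → S`). [folklore] -/
theorem exists_artinianPresentation {𝒳 S : SchemeOver ℂ} (π : 𝒳 ⟶ S) (s₀ : ComplexPoints S)
    (X₀ : SchemeOver ℂ) (e : X₀ ≅ fiberOver π s₀) {A B : Type} [CommRing A] [Algebra ℂ A] [CommRing B]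
    [Algebra ℂ B] (φ : A →ₐ[ℂ] B) (ρ : B →ₐ[ℂ] ℂ) (a : specOver ℂ A ⟶ S)
    (ha : Spec.map (CommRingCat.ofHom (ρ.comp φ).toRingHom) ≫ a.left = s₀.left) :
    ∃ (XA XB : Scheme) (gA : XA ⟶ 𝒳.left) (qA : XA ⟶ Spec (.of A)) (_ : IsPullback gA qA π.left a.left)
      (i : XB ⟶ XA) (qB : XB ⟶ Spec (.of B))
      (_ : IsPullback i qB qA (Spec.map (CommRingCat.ofHom φ.toRingHom))) (j : X₀.left ⟶ XB)
      (_ : IsPullback j X₀.hom qB (Spec.map (CommRingCat.ofHom ρ.toRingHom))),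
      j ≫ i ≫ gA = e.hom.left ≫ (fiberι π s₀).left := by
  have hA : IsPullback (pullback.fst π.left a.left) (pullback.snd π.left a.left) π.left a.left :=
    IsPullback.of_hasPullback _ _
  have hB : IsPullback (pullback.fst (pullback.snd π.left a.left) (Spec.map (CommRingCat.ofHom φ.toRingHom)))
      (pullback.snd (pullback.snd π.left a.left) (Spec.map (CommRingCat.ofHom φ.toRingHom)))
      (pullback.snd π.left a.left) (Spec.map (CommRingCat.ofHom φ.toRingHom)) :=
    IsPullback.of_hasPullback _ _
  have hBA := hB.paste_horiz hA
  have ha' : Spec.map (CommRingCat.ofHom ρ.toRingHom) ≫ Spec.map (CommRingCat.ofHom φ.toRingHom) ≫ a.left =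
      s₀.left := by
    rw [← ha, ← Spec.map_comp_assoc]
    rfl
  have hw₂ : e.hom.left ≫ (fiberOverToSpec π s₀).left = X₀.hom := left_comp_fiberOverToSpec_left π s₀ e.hom
  have houter₀ : IsPullback (e.hom.left ≫ (fiberι π s₀).left) X₀.hom π.left s₀.left := by
    refine IsPullback.of_iso_pullback ⟨?_⟩ ((Over.forget _).mapIso e) rfl hw₂
    rw [Category.assoc, show (fiberι π s₀).left ≫ π.left = (fiberOverToSpec π s₀).left ≫ s₀.left from
      pullback.condition, ← hw₂]
    exact (Category.assoc _ _ _).symm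
  have houter : IsPullback (e.hom.left ≫ (fiberι π s₀).left) X₀.hom π.left
      (Spec.map (CommRingCat.ofHom ρ.toRingHom) ≫
        Spec.map (CommRingCat.ofHom φ.toRingHom) ≫ a.left) := by
    rw [ha']
    exact houter₀
  refine ⟨_, _, pullback.fst π.left a.left, pullback.snd π.left a.left, hA, _, _, hB,
    hBA.lift (e.hom.left ≫ (fiberι π s₀).left) (X₀.hom ≫ Spec.map (CommRingCat.ofHom ρ.toRingHom))
      (by rw [houter.w]; exact (Category.assoc _ _ _).symm),
    IsPullback.of_right' houter hBA, ?_⟩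
  exact hBA.lift_fst _ _ _

end Presentation

end Summit.Ventures.HSemireg

end
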